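import Summits.QuantumFields.YangMills.Theorems.UnitScaleTiltProp7PointLandauDivergence
import HarnessLib

/-!
# Route `UnitScaleTilt`, crux K1 child «MinimiserStabilityRegPr» (stmt-QuantumFields-19200), route-R GROWTH (MAP #3 M10, S3 «nonlinear passage») —
# THE PASSAGE WITH THE DIVERGENCE DISPLAYED AS A BUDGET, part 2∕3: THE POINT-LANDAU DIVERGENCE BUDGETS of the `ℓ²`-optimal representatives
# (`Σ_x‖D^*_{U₀}Y(x)‖²_HS ≤ 6s²·Σ_b‖Y_b‖²` at the stationary sites; pinned: plus a displayed centre debit; unpinned: every site is stationary)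

Cell `ym3-torus`, keyed width hand `ym-routeR-w3` (D-0154 (3c); MAP #3 row M10; LOCATED 2026-08-28 05:10Z on the cell bus).  THEOREMS ONLY (0 `def`, 0 `sorry`);
`--supports stmt-QuantumFields-19200`, count-neutral.  YM₃ on T³ is a ladder rung (R3), not the Clay problem; nothing here claims the stub, the crux, d = 4 or the mass gap.

WHY (numbers).  Brick (a) (`Prop7PointLandauDivergence`, ✓ p605285) proves, for the PINNED `ℓ²`-optimal representative and `x` OFF the `(K−n)`-fold centres,
`(D^*_{U₀}Y)(x) = ½(Σ_μ Y(x,μ)ᴴY(x,μ) − Σ_μ U₀^*YᴴYU₀)` exactly and `Σ_jk|(D^*Y)(x)_jk|² ≤ ½m_x²`, `m_x := Σ_{b∋x}‖Y_b‖²`.  Here: (§1) the same algebra with the site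
stationarity DISPLAYED as the hypothesis (so it serves any representative stationary at `x`); (§2) the UNPINNED `ℓ²`-optimum (optimal over the full gauge orbit) is stationary
at EVERY site (the one-site variation needs no membership in the pinned group (4)); (§3) the budgets: `m_x ≤ 2d·s²` under `‖Y_b‖ ≤ s`, so `Σ_jk|(D^*Y)(x)_jk|² ≤ d·s²·m_x`, and
`Σ_x m_x = 2Σ_b‖Y_b‖²` (both ends of every bond), whence `Σ_x‖D^*Y(x)‖²_HS ≤ 2d·s²·Σ_b‖Y_b‖² = 6s²·Σ_b‖Y_b‖²` over the stationary sites (d = 3); for the pinned optimum the centres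
carry NO condition and enter as a displayed nonnegative debit `Σ_xζ_C(x)`.  Part 3∕3 (`…Prop7RelPoincareOptRepr`) feeds these into part 1∕3's `hdivB`.

WHAT IS PROVED (ns `…Theorems.Prop7PointLandauBudget`).
* §1 `divB_eq_half_of_siteStationary`, `sum_normSq_divB_le_of_siteStationary` (brick (a) with the stationarity displayed; proofs = ✓ p605285's, one line changed).
* §2 `optimalReprAll_site_ineq`, `optimalReprAll_site_stationary` (unpinned optimum, every site; = `Prop7OptimalSlice` §3–§4 without the centre proviso).
* §3 `sum_incident_eq`, `le_half_mul_of_le_half_sq`, `incident_normSq_le` (arithmetic); ★ `sum_hs_divB_le_of_optAll` (`≤ 6s²·Σ‖Y‖²`); ★ `sum_hs_divB_le_of_pinnedOpt`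
  (`≤ 6s²·Σ‖Y‖² + Σ_xζ_C(x)`).

HONEST SCOPE.  Finite-dimensional algebra and finite sums over ✓ p605285 ∕ `Prop7OptimalSlice`; the centre debit is displayed, not estimated; nothing of Bałaban's analysis is asserted.

References: T. Bałaban, CMP 99 (1985) 389–434 [Balaban1985BackgroundPropagators] ((3.8) p.392, Thm 3.11 p.416); CMP 102 (1985) 277–309 [Balaban1985Variational] ((4) p.278,
(14) p.280, (22)–(28) pp.281–282, (141)–(143) p.299); CMP 99 (1985) 75–102 [Balaban1985RegularSpaces] ((1.38) p.82).
-/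

set_option autoImplicit false

noncomputable section

open scoped BigOperators Matrix.Norms.L2Operator Matrix Topology

namespace Summit.QuantumFields.YangMills.Theorems.Prop7PointLandauBudget

open Filter NormedSpace
open Literature.MathematicalPhysics.QuantumFieldTheory.Balaban1983to89
open Literature.MathematicalPhysics.QuantumFieldTheory.Balaban1983to89.T3ContinuumYM3Torus
open Literature.MathematicalPhysics.QuantumFieldTheory.Balaban1983to89.T3PrintedRegularOrbits (descTransf)
open Finset B1RG242Torus
open T4Continuum B15DeterminingSets
open B9Eq39Adjoint (divB)
open B10Eq27TorusAxialLog (unitsField toUField)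
open B9TorusCalculus (torusT)
open BlockAveragingEMLLinearisedBackground (pertVar)
open Summit.QuantumFields.YangMills.Theorems.Prop7CovariantCoercivity (re_trace_conjTranspose_mul_self sum_norm_sq_le_mul_opNorm_sq)
open Summit.QuantumFields.YangMills.Theorems.Prop7PointLandauDivergence (divB_apply conjTranspose_eq_of_su_orthogonal add_conjTranspose_eq_neg_mul
  norm_conjTranspose_mul_self_le sum_normSq_divB_optimalRepr_le)
open Summit.QuantumFields.YangMills.Theorems.Prop7OptimalSlice (sum_normSq_pertVar_siteUpdate_sub hasDerivAt_siteFunctional)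
open Summit.QuantumFields.YangMills.Theorems.Prop7FlatCoercivity (sum_shift)
open B10StarCount (sum_pbond)

/-! ## §1 The point-Landau divergence with the site stationarity DISPLAYED (serves pinned and unpinned optima) -/

section Stationary

variable (F : T3Family) {n K : ℕ}

/-- **BRICK (a)'s IDENTITY WITH THE STATIONARITY DISPLAYED**: if at the site `x` the `𝔰𝔲(2)`-stationarity `Σ_μ Re Tr(X·W(x,μ)U₀(x,μ)^*) = Σ_μ Re Tr(X·U₀(x−e_μ,μ)^*W(x−e_μ,μ))`
holds for every skew-Hermitian traceless `X` (pinned optimum off the centres: `Prop7OptimalSlice.optimalRepr_site_stationary`; unpinned optimum: every site, §2 below), then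
`(D^*_{U₀}Y)(x) = ½·(Σ_μ Y(x,μ)ᴴY(x,μ) − Σ_μ U₀(x−e_μ,μ)^*·Y(x−e_μ,μ)ᴴY(x−e_μ,μ)·U₀(x−e_μ,μ))`, `Y = WU₀^* − 1` — the proof is ✓ p605285's `divB_optimalRepr_eq` verbatim
with the stationarity taken as the hypothesis. [cite: Balaban1985RegularSpaces, (1.38) p.82; Balaban1985BackgroundPropagators, (3.8) p.392] -/
theorem divB_eq_half_of_siteStationary (U₀ W : GaugeField (F.P K) 0 (Matrix.specialUnitaryGroup (Fin 2) ℂ)) (x : Site (F.P K) 0)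
    (hstat0 : ∀ X : Matrix (Fin 2) (Fin 2) ℂ, X ∈ skewAdjoint (Matrix (Fin 2) (Fin 2) ℂ) → X.trace = 0 →
      ∑ μ : Fin (F.P K).d, ((X * ((W ⟨x, μ⟩ : Matrix (Fin 2) (Fin 2) ℂ) * star (U₀ ⟨x, μ⟩ : Matrix (Fin 2) (Fin 2) ℂ))).trace).re =
        ∑ μ : Fin (F.P K).d, ((X * (star (U₀ ⟨x.unshift μ, μ⟩ : Matrix (Fin 2) (Fin 2) ℂ) * (W ⟨x.unshift μ, μ⟩ : Matrix (Fin 2) (Fin 2) ℂ))).trace).re) :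
    divB (torusT (F.P K) 0) (fun κ z => unitsField (toUField U₀) ⟨z, κ⟩) (fun κ z => (W ⟨z, κ⟩ : Matrix (Fin 2) (Fin 2) ℂ) * star (U₀ ⟨z, κ⟩ : Matrix (Fin 2) (Fin 2) ℂ) - 1) x
      = (2 : ℂ)⁻¹ • (∑ μ : Fin (F.P K).d, ((W ⟨x, μ⟩ : Matrix (Fin 2) (Fin 2) ℂ) * star (U₀ ⟨x, μ⟩ : Matrix (Fin 2) (Fin 2) ℂ) - 1)ᴴ * ((W ⟨x, μ⟩ : Matrix (Fin 2) (Fin 2) ℂ) * star (U₀ ⟨x, μ⟩ : Matrix (Fin 2) (Fin 2) ℂ) - 1)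
          - ∑ μ : Fin (F.P K).d, star (U₀ ⟨x.unshift μ, μ⟩ : Matrix (Fin 2) (Fin 2) ℂ) * (((W ⟨x.unshift μ, μ⟩ : Matrix (Fin 2) (Fin 2) ℂ) * star (U₀ ⟨x.unshift μ, μ⟩ : Matrix (Fin 2) (Fin 2) ℂ) - 1)ᴴ * ((W ⟨x.unshift μ, μ⟩ : Matrix (Fin 2) (Fin 2) ℂ) * star (U₀ ⟨x.unshift μ, μ⟩ : Matrix (Fin 2) (Fin 2) ℂ) - 1)) * (U₀ ⟨x.unshift μ, μ⟩ : Matrix (Fin 2) (Fin 2) ℂ)) := by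
  -- the letters
  set D : Matrix (Fin 2) (Fin 2) ℂ := ∑ μ : Fin (F.P K).d, ((W ⟨x, μ⟩ : Matrix (Fin 2) (Fin 2) ℂ) * star (U₀ ⟨x, μ⟩ : Matrix (Fin 2) (Fin 2) ℂ) - 1)
      - ∑ μ : Fin (F.P K).d, star (U₀ ⟨x.unshift μ, μ⟩ : Matrix (Fin 2) (Fin 2) ℂ) * ((W ⟨x.unshift μ, μ⟩ : Matrix (Fin 2) (Fin 2) ℂ) * star (U₀ ⟨x.unshift μ, μ⟩ : Matrix (Fin 2) (Fin 2) ℂ) - 1) * (U₀ ⟨x.unshift μ, μ⟩ : Matrix (Fin 2) (Fin 2) ℂ) with hD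
  have hUU : ∀ b : PBond (F.P K) 0, star (U₀ b : Matrix (Fin 2) (Fin 2) ℂ) * (U₀ b : Matrix (Fin 2) (Fin 2) ℂ) = 1 := fun b => Matrix.mem_unitaryGroup_iff'.mp (U₀ b).2.1
  have hUU' : ∀ b : PBond (F.P K) 0, (U₀ b : Matrix (Fin 2) (Fin 2) ℂ) * star (U₀ b : Matrix (Fin 2) (Fin 2) ℂ) = 1 := fun b => Matrix.mem_unitaryGroup_iff.mp (U₀ b).2.1
  -- (1) `divB = −D`
  have hdiv : divB (torusT (F.P K) 0) (fun κ z => unitsField (toUField U₀) ⟨z, κ⟩) (fun κ z => (W ⟨z, κ⟩ : Matrix (Fin 2) (Fin 2) ℂ) * star (U₀ ⟨z, κ⟩ : Matrix (Fin 2) (Fin 2) ℂ) - 1) x = -D := by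
    rw [divB_apply F U₀, hD, Finset.sum_sub_distrib, neg_sub]
  -- (2) stationarity: `Re Tr(X·D) = 0` for every `X ∈ 𝔰𝔲(2)`
  have hstat : ∀ X : Matrix (Fin 2) (Fin 2) ℂ, Xᴴ = -X → X.trace = 0 → ((X * D).trace).re = 0 := by
    intro X hX htr
    have hXs : X ∈ skewAdjoint (Matrix (Fin 2) (Fin 2) ℂ) := by rw [skewAdjoint.mem_iff, Matrix.star_eq_conjTranspose, hX]
    have h0 := hstat0 X hXs htr
    -- `D = Σ_μ W(x,μ)U₀(x,μ)^* − Σ_μ U₀(x−e_μ,μ)^*W(x−e_μ,μ)` (the `1`'s cancel since `U₀^*U₀ = 1`)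
    have e2 : ∀ μ : Fin (F.P K).d, star (U₀ ⟨x.unshift μ, μ⟩ : Matrix (Fin 2) (Fin 2) ℂ) * ((W ⟨x.unshift μ, μ⟩ : Matrix (Fin 2) (Fin 2) ℂ) * star (U₀ ⟨x.unshift μ, μ⟩ : Matrix (Fin 2) (Fin 2) ℂ) - 1) * (U₀ ⟨x.unshift μ, μ⟩ : Matrix (Fin 2) (Fin 2) ℂ) = star (U₀ ⟨x.unshift μ, μ⟩ : Matrix (Fin 2) (Fin 2) ℂ) * (W ⟨x.unshift μ, μ⟩ : Matrix (Fin 2) (Fin 2) ℂ) - 1 := by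
      intro μ
      have hu := hUU ⟨x.unshift μ, μ⟩
      calc star (U₀ ⟨x.unshift μ, μ⟩ : Matrix (Fin 2) (Fin 2) ℂ) * ((W ⟨x.unshift μ, μ⟩ : Matrix (Fin 2) (Fin 2) ℂ) * star (U₀ ⟨x.unshift μ, μ⟩ : Matrix (Fin 2) (Fin 2) ℂ) - 1) * (U₀ ⟨x.unshift μ, μ⟩ : Matrix (Fin 2) (Fin 2) ℂ)
          = star (U₀ ⟨x.unshift μ, μ⟩ : Matrix (Fin 2) (Fin 2) ℂ) * (W ⟨x.unshift μ, μ⟩ : Matrix (Fin 2) (Fin 2) ℂ) * (star (U₀ ⟨x.unshift μ, μ⟩ : Matrix (Fin 2) (Fin 2) ℂ) * (U₀ ⟨x.unshift μ, μ⟩ : Matrix (Fin 2) (Fin 2) ℂ)) - star (U₀ ⟨x.unshift μ, μ⟩ : Matrix (Fin 2) (Fin 2) ℂ) * (U₀ ⟨x.unshift μ, μ⟩ : Matrix (Fin 2) (Fin 2) ℂ) := by noncomm_ring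
        _ = star (U₀ ⟨x.unshift μ, μ⟩ : Matrix (Fin 2) (Fin 2) ℂ) * (W ⟨x.unshift μ, μ⟩ : Matrix (Fin 2) (Fin 2) ℂ) - 1 := by rw [hu, Matrix.mul_one]
    have hDalt : D = ∑ μ : Fin (F.P K).d, (W ⟨x, μ⟩ : Matrix (Fin 2) (Fin 2) ℂ) * star (U₀ ⟨x, μ⟩ : Matrix (Fin 2) (Fin 2) ℂ) - ∑ μ : Fin (F.P K).d, star (U₀ ⟨x.unshift μ, μ⟩ : Matrix (Fin 2) (Fin 2) ℂ) * (W ⟨x.unshift μ, μ⟩ : Matrix (Fin 2) (Fin 2) ℂ) := by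
      rw [hD]; simp only [e2, Finset.sum_sub_distrib]; abel
    rw [hDalt, Matrix.mul_sub, Matrix.mul_sum, Matrix.mul_sum, Matrix.trace_sub, Matrix.trace_sum, Matrix.trace_sum, Complex.sub_re, Complex.re_sum,
      Complex.re_sum, h0, sub_self]
  -- (3) `tr D` is real: `tr Y_b = tr(W_bU₀_b⁻¹) − 2` with `W_bU₀_b⁻¹ ∈ SU(2)`, and `tr(U^*YU) = tr Y`
  have htrY : ∀ b : PBond (F.P K) 0, ((((W b : Matrix (Fin 2) (Fin 2) ℂ) * star (U₀ b : Matrix (Fin 2) (Fin 2) ℂ) - 1)).trace).im = 0 := fun b => by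
    have hV : (((W b * (U₀ b)⁻¹ : Matrix.specialUnitaryGroup (Fin 2) ℂ) : Matrix (Fin 2) (Fin 2) ℂ).trace).im = 0 := Literature.MathematicalPhysics.QuantumLattice.NarrowWell.trace_im_eq_zero _
    have e : (W b : Matrix (Fin 2) (Fin 2) ℂ) * star (U₀ b : Matrix (Fin 2) (Fin 2) ℂ) = ((W b * (U₀ b)⁻¹ : Matrix.specialUnitaryGroup (Fin 2) ℂ) : Matrix (Fin 2) (Fin 2) ℂ) := rfl
    rw [Matrix.trace_sub, Complex.sub_im, e, hV, Matrix.trace_one]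
    simp
  have htrD : (D.trace).im = 0 := by
    rw [hD, Matrix.trace_sub, Matrix.trace_sum, Matrix.trace_sum, Complex.sub_im, Complex.im_sum, Complex.im_sum]
    have e : ∀ μ : Fin (F.P K).d, (star (U₀ ⟨x.unshift μ, μ⟩ : Matrix (Fin 2) (Fin 2) ℂ) * ((W ⟨x.unshift μ, μ⟩ : Matrix (Fin 2) (Fin 2) ℂ) * star (U₀ ⟨x.unshift μ, μ⟩ : Matrix (Fin 2) (Fin 2) ℂ) - 1) * (U₀ ⟨x.unshift μ, μ⟩ : Matrix (Fin 2) (Fin 2) ℂ)).trace = (((W ⟨x.unshift μ, μ⟩ : Matrix (Fin 2) (Fin 2) ℂ) * star (U₀ ⟨x.unshift μ, μ⟩ : Matrix (Fin 2) (Fin 2) ℂ) - 1)).trace := fun μ => by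
      rw [Matrix.trace_mul_cycle, hUU', Matrix.one_mul]
    simp only [e, htrY, Finset.sum_const_zero, sub_zero]
  -- (4) 𝔰𝔲-separation: `D` is Hermitian, hence equal to half of `D + Dᴴ`, which is quadratic by the unitary polarisation
  have hDh : Dᴴ = D := conjTranspose_eq_of_su_orthogonal D hstat htrD
  have hpol : ∀ b : PBond (F.P K) 0, ((W b : Matrix (Fin 2) (Fin 2) ℂ) * star (U₀ b : Matrix (Fin 2) (Fin 2) ℂ) - 1) + ((W b : Matrix (Fin 2) (Fin 2) ℂ) * star (U₀ b : Matrix (Fin 2) (Fin 2) ℂ) - 1)ᴴ = -(((W b : Matrix (Fin 2) (Fin 2) ℂ) * star (U₀ b : Matrix (Fin 2) (Fin 2) ℂ) - 1)ᴴ * ((W b : Matrix (Fin 2) (Fin 2) ℂ) * star (U₀ b : Matrix (Fin 2) (Fin 2) ℂ) - 1)) := fun b =>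
    add_conjTranspose_eq_neg_mul ((W b * (U₀ b)⁻¹ : Matrix.specialUnitaryGroup (Fin 2) ℂ)).2.1
  have hsum : D + Dᴴ = -(∑ μ : Fin (F.P K).d, ((W ⟨x, μ⟩ : Matrix (Fin 2) (Fin 2) ℂ) * star (U₀ ⟨x, μ⟩ : Matrix (Fin 2) (Fin 2) ℂ) - 1)ᴴ * ((W ⟨x, μ⟩ : Matrix (Fin 2) (Fin 2) ℂ) * star (U₀ ⟨x, μ⟩ : Matrix (Fin 2) (Fin 2) ℂ) - 1)
          - ∑ μ : Fin (F.P K).d, star (U₀ ⟨x.unshift μ, μ⟩ : Matrix (Fin 2) (Fin 2) ℂ) * (((W ⟨x.unshift μ, μ⟩ : Matrix (Fin 2) (Fin 2) ℂ) * star (U₀ ⟨x.unshift μ, μ⟩ : Matrix (Fin 2) (Fin 2) ℂ) - 1)ᴴ * ((W ⟨x.unshift μ, μ⟩ : Matrix (Fin 2) (Fin 2) ℂ) * star (U₀ ⟨x.unshift μ, μ⟩ : Matrix (Fin 2) (Fin 2) ℂ) - 1)) * (U₀ ⟨x.unshift μ, μ⟩ : Matrix (Fin 2) (Fin 2) ℂ))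 := by
    rw [hD, Matrix.conjTranspose_sub, Matrix.conjTranspose_sum, Matrix.conjTranspose_sum]
    have e : ∀ μ : Fin (F.P K).d, (star (U₀ ⟨x.unshift μ, μ⟩ : Matrix (Fin 2) (Fin 2) ℂ) * ((W ⟨x.unshift μ, μ⟩ : Matrix (Fin 2) (Fin 2) ℂ) * star (U₀ ⟨x.unshift μ, μ⟩ : Matrix (Fin 2) (Fin 2) ℂ) - 1) * (U₀ ⟨x.unshift μ, μ⟩ : Matrix (Fin 2) (Fin 2) ℂ))ᴴ = star (U₀ ⟨x.unshift μ, μ⟩ : Matrix (Fin 2) (Fin 2) ℂ) * ((W ⟨x.unshift μ, μ⟩ : Matrix (Fin 2) (Fin 2) ℂ) * star (U₀ ⟨x.unshift μ, μ⟩ : Matrix (Fin 2) (Fin 2) ℂ) - 1)ᴴ * (U₀ ⟨x.unshift μ, μ⟩ : Matrix (Fin 2) (Fin 2) ℂ) := fun μ => by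
      rw [Matrix.conjTranspose_mul, Matrix.conjTranspose_mul, ← Matrix.star_eq_conjTranspose (star (U₀ ⟨x.unshift μ, μ⟩ : Matrix (Fin 2) (Fin 2) ℂ)), star_star,
        ← Matrix.star_eq_conjTranspose (U₀ ⟨x.unshift μ, μ⟩ : Matrix (Fin 2) (Fin 2) ℂ), Matrix.mul_assoc]
    simp only [e]
    rw [show ∀ a b c d : Matrix (Fin 2) (Fin 2) ℂ, a - b + (c - d) = (a + c) - (b + d) from fun a b c d => by abel, ← Finset.sum_add_distrib, ← Finset.sum_add_distrib]
    have e2 : ∀ μ : Fin (F.P K).d, star (U₀ ⟨x.unshift μ, μ⟩ : Matrix (Fin 2) (Fin 2) ℂ) * ((W ⟨x.unshift μ, μ⟩ : Matrix (Fin 2) (Fin 2) ℂ) * star (U₀ ⟨x.unshift μ, μ⟩ : Matrix (Fin 2) (Fin 2) ℂ) - 1) * (U₀ ⟨x.unshift μ, μ⟩ : Matrix (Fin 2) (Fin 2) ℂ) + star (U₀ ⟨x.unshift μ, μ⟩ : Matrix (Fin 2) (Fin 2) ℂ) * ((W ⟨x.unshift μ, μ⟩ : Matrix (Fin 2) (Fin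 2) ℂ) * star (U₀ ⟨x.unshift μ, μ⟩ : Matrix (Fin 2) (Fin 2) ℂ) - 1)ᴴ * (U₀ ⟨x.unshift μ, μ⟩ : Matrix (Fin 2) (Fin 2) ℂ)
        = -(star (U₀ ⟨x.unshift μ, μ⟩ : Matrix (Fin 2) (Fin 2) ℂ) * (((W ⟨x.unshift μ, μ⟩ : Matrix (Fin 2) (Fin 2) ℂ) * star (U₀ ⟨x.unshift μ, μ⟩ : Matrix (Fin 2) (Fin 2) ℂ) - 1)ᴴ * ((W ⟨x.unshift μ, μ⟩ : Matrix (Fin 2) (Fin 2) ℂ) * star (U₀ ⟨x.unshift μ, μ⟩ : Matrix (Fin 2) (Fin 2) ℂ) - 1)) * (U₀ ⟨x.unshift μ, μ⟩ : Matrix (Fin 2) (Fin 2) ℂ)) := fun μ => by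
      rw [← Matrix.add_mul, ← Matrix.mul_add, hpol, Matrix.mul_neg, Matrix.neg_mul]
    simp only [hpol, e2, Finset.sum_neg_distrib]
    abel
  -- assemble
  rw [hdiv]
  have hD2 : D = (2 : ℂ)⁻¹ • (D + Dᴴ) := by
    rw [hDh, ← two_smul ℂ D, smul_smul, inv_mul_cancel₀ two_ne_zero, one_smul]
  rw [hD2, hsum, smul_neg, neg_neg]

/-- **HILBERT–SCHMIDT SIZE UNDER DISPLAYED STATIONARITY**: `Σ_jk|(D^*_{U₀}Y)(x)_jk|² ≤ ½·(Σ_μ‖Y(x,μ)‖² + Σ_μ‖Y(x−e_μ,μ)‖²)²` at every stationary site (✓ p605285's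
`norm_divB_optimalRepr_le` ∕ `sum_normSq_divB_optimalRepr_le`, stationarity displayed). [cite: Balaban1985RegularSpaces, (1.38) p.82; Balaban1985BackgroundPropagators, (3.8) p.392] -/
theorem sum_normSq_divB_le_of_siteStationary (U₀ W : GaugeField (F.P K) 0 (Matrix.specialUnitaryGroup (Fin 2) ℂ)) (x : Site (F.P K) 0)
    (hstat0 : ∀ X : Matrix (Fin 2) (Fin 2) ℂ, X ∈ skewAdjoint (Matrix (Fin 2) (Fin 2) ℂ) → X.trace = 0 →
      ∑ μ : Fin (F.P K).d, ((X * ((W ⟨x, μ⟩ : Matrix (Fin 2) (Fin 2) ℂ) * star (U₀ ⟨x, μ⟩ : Matrix (Fin 2) (Fin 2) ℂ))).trace).re =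
        ∑ μ : Fin (F.P K).d, ((X * (star (U₀ ⟨x.unshift μ, μ⟩ : Matrix (Fin 2) (Fin 2) ℂ) * (W ⟨x.unshift μ, μ⟩ : Matrix (Fin 2) (Fin 2) ℂ))).trace).re) :
    ∑ j : Fin 2, ∑ k : Fin 2, ‖(divB (torusT (F.P K) 0) (fun κ z => unitsField (toUField U₀) ⟨z, κ⟩) (fun κ z => (W ⟨z, κ⟩ : Matrix (Fin 2) (Fin 2) ℂ) * star (U₀ ⟨z, κ⟩ : Matrix (Fin 2) (Fin 2) ℂ) - 1) x) j k‖ ^ 2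
      ≤ (1 / 2) * (∑ μ : Fin (F.P K).d, ‖((W ⟨x, μ⟩ : Matrix (Fin 2) (Fin 2) ℂ) * star (U₀ ⟨x, μ⟩ : Matrix (Fin 2) (Fin 2) ℂ) - 1)‖ ^ 2 + ∑ μ : Fin (F.P K).d, ‖((W ⟨x.unshift μ, μ⟩ : Matrix (Fin 2) (Fin 2) ℂ) * star (U₀ ⟨x.unshift μ, μ⟩ : Matrix (Fin 2) (Fin 2) ℂ) - 1)‖ ^ 2) ^ 2 := by
  -- operator norm first
  have hn : ‖divB (torusT (F.P K) 0) (fun κ z => unitsField (toUField U₀) ⟨z, κ⟩) (fun κ z => (W ⟨z, κ⟩ : Matrix (Fin 2) (Fin 2) ℂ) * star (U₀ ⟨z, κ⟩ : Matrix (Fin 2) (Fin 2) ℂ) - 1) x‖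
      ≤ (1 / 2) * (∑ μ : Fin (F.P K).d, ‖((W ⟨x, μ⟩ : Matrix (Fin 2) (Fin 2) ℂ) * star (U₀ ⟨x, μ⟩ : Matrix (Fin 2) (Fin 2) ℂ) - 1)‖ ^ 2 + ∑ μ : Fin (F.P K).d, ‖((W ⟨x.unshift μ, μ⟩ : Matrix (Fin 2) (Fin 2) ℂ) * star (U₀ ⟨x.unshift μ, μ⟩ : Matrix (Fin 2) (Fin 2) ℂ) - 1)‖ ^ 2) := by
    rw [divB_eq_half_of_siteStationary F U₀ W x hstat0, norm_smul, norm_inv, Complex.norm_ofNat]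
    have hA : ‖∑ μ : Fin (F.P K).d, ((W ⟨x, μ⟩ : Matrix (Fin 2) (Fin 2) ℂ) * star (U₀ ⟨x, μ⟩ : Matrix (Fin 2) (Fin 2) ℂ) - 1)ᴴ * ((W ⟨x, μ⟩ : Matrix (Fin 2) (Fin 2) ℂ) * star (U₀ ⟨x, μ⟩ : Matrix (Fin 2) (Fin 2) ℂ) - 1)‖ ≤ ∑ μ : Fin (F.P K).d, ‖((W ⟨x, μ⟩ : Matrix (Fin 2) (Fin 2) ℂ) * star (U₀ ⟨x, μ⟩ : Matrix (Fin 2) (Fin 2) ℂ) - 1)‖ ^ 2 :=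
      (norm_sum_le _ _).trans (Finset.sum_le_sum fun μ _ => (norm_conjTranspose_mul_self_le _ (U₀ ⟨x, μ⟩)).1)
    have hB : ‖∑ μ : Fin (F.P K).d, star (U₀ ⟨x.unshift μ, μ⟩ : Matrix (Fin 2) (Fin 2) ℂ) * (((W ⟨x.unshift μ, μ⟩ : Matrix (Fin 2) (Fin 2) ℂ) * star (U₀ ⟨x.unshift μ, μ⟩ : Matrix (Fin 2) (Fin 2) ℂ) - 1)ᴴ * ((W ⟨x.unshift μ, μ⟩ : Matrix (Fin 2) (Fin 2) ℂ) * star (U₀ ⟨x.unshift μ, μ⟩ : Matrix (Fin 2) (Fin 2) ℂ) - 1)) * (U₀ ⟨x.unshift μ, μ⟩ : Matrix (Fin 2) (Fin 2) ℂ)‖ ≤ ∑ μ : Fin (F.P K).d, ‖((W ⟨x.unshift μ, μ⟩ : Matrix (Fin 2) (Fin 2) ℂ) * star (U₀ ⟨x.unshift μ, μ⟩ : Matrix (Fin 2) (Fin 2) ℂ) - 1)‖ ^ 2 :=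
      (norm_sum_le _ _).trans (Finset.sum_le_sum fun μ _ => (norm_conjTranspose_mul_self_le _ (U₀ ⟨x.unshift μ, μ⟩)).2)
    have hsub := norm_sub_le (∑ μ : Fin (F.P K).d, ((W ⟨x, μ⟩ : Matrix (Fin 2) (Fin 2) ℂ) * star (U₀ ⟨x, μ⟩ : Matrix (Fin 2) (Fin 2) ℂ) - 1)ᴴ * ((W ⟨x, μ⟩ : Matrix (Fin 2) (Fin 2) ℂ) * star (U₀ ⟨x, μ⟩ : Matrix (Fin 2) (Fin 2) ℂ) - 1))
      (∑ μ : Fin (F.P K).d, star (U₀ ⟨x.unshift μ, μ⟩ : Matrix (Fin 2) (Fin 2) ℂ) * (((W ⟨x.unshift μ, μ⟩ : Matrix (Fin 2) (Fin 2) ℂ) * star (U₀ ⟨x.unshift μ, μ⟩ : Matrix (Fin 2) (Fin 2) ℂ) - 1)ᴴ * ((W ⟨x.unshift μ, μ⟩ : Matrix (Fin 2) (Fin 2) ℂ) * star (U₀ ⟨x.unshift μ, μ⟩ : Matrix (Fin 2) (Fin 2) ℂ) - 1)) * (U₀ ⟨x.unshift μ, μ⟩ : Matrix (Fin 2) (Fin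 2) ℂ))
    have h2 : (2 : ℝ)⁻¹ = 1 / 2 := by norm_num
    rw [h2]
    exact mul_le_mul_of_nonneg_left (hsub.trans (add_le_add hA hB)) (by norm_num)
  have hHS := sum_norm_sq_le_mul_opNorm_sq (divB (torusT (F.P K) 0) (fun κ z => unitsField (toUField U₀) ⟨z, κ⟩) (fun κ z => (W ⟨z, κ⟩ : Matrix (Fin 2) (Fin 2) ℂ) * star (U₀ ⟨z, κ⟩ : Matrix (Fin 2) (Fin 2) ℂ) - 1) x)
  push_cast at hHS
  have h0 : 0 ≤ ‖divB (torusT (F.P K) 0) (fun κ z => unitsField (toUField U₀) ⟨z, κ⟩) (fun κ z => (W ⟨z, κ⟩ : Matrix (Fin 2) (Fin 2) ℂ) * star (U₀ ⟨z, κ⟩ : Matrix (Fin 2) (Fin 2) ℂ) - 1) x‖ := norm_nonneg _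
  have hsq := pow_le_pow_left₀ h0 hn 2
  nlinarith [hHS, hsq]

end Stationary

/-! ## §2 The unpinned `ℓ²`-optimum is stationary at EVERY site -/

section OptAll

variable {P : Params} {j : ℕ}

/-- **THE SLICE INEQUALITY OF THE UNPINNED OPTIMUM, EXACT FORM**: if `W` minimises `Σ_b‖W_bU_b⁻¹ − 1‖²` over its FULL gauge orbit (no pinning), then at EVERY site `x` and for every
`c ∈ SU(2)`: `Σ_μ Re Tr((c − 1)·W(x,μ)U(x,μ)^*) + Σ_μ Re Tr((c^* − 1)·U(x−e_μ,μ)^*W(x−e_μ,μ)) ≤ 0` (`Prop7OptimalSlice.optimalRepr_site_ineq` without the centre proviso —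
the one-site variation needs no membership in (4)). [cite: Balaban1985RegularSpaces, (1.19)-(1.20) p.79, (1.38) p.82] -/
theorem optimalReprAll_site_ineq (U W : GaugeField P j (Matrix.specialUnitaryGroup (Fin 2) ℂ))
    (hopt : ∀ v : GaugeTransf P j (Matrix.specialUnitaryGroup (Fin 2) ℂ),
      ∑ b : PBond P j, ‖pertVar U W b‖ ^ 2 ≤ ∑ b : PBond P j, ‖pertVar U (GaugeField.gaugeAct v W) b‖ ^ 2)
    (x : Site P j) (c : Matrix.specialUnitaryGroup (Fin 2) ℂ) :
    (∑ μ : Fin P.d, ((((c : Matrix (Fin 2) (Fin 2) ℂ) - 1) *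
        ((W ⟨x, μ⟩ : Matrix (Fin 2) (Fin 2) ℂ) * star (U ⟨x, μ⟩ : Matrix (Fin 2) (Fin 2) ℂ))).trace).re) +
      ∑ μ : Fin P.d, (((star (c : Matrix (Fin 2) (Fin 2) ℂ) - 1) *
        (star (U ⟨x.unshift μ, μ⟩ : Matrix (Fin 2) (Fin 2) ℂ) * (W ⟨x.unshift μ, μ⟩ : Matrix (Fin 2) (Fin 2) ℂ))).trace).re ≤ 0 := by
  classical
  have h1 := hopt (Function.update (fun _ : Site P j => (1 : Matrix.specialUnitaryGroup (Fin 2) ℂ)) x c)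
  have h2 := sum_normSq_pertVar_siteUpdate_sub U W x c
  linarith

/-- **THE UNPINNED `ℓ²`-OPTIMUM IS POINT-LANDAU AT EVERY SITE** (infinitesimal form): for `W` optimal over its full gauge orbit relative to `U`, at every site `x` and every
`X ∈ 𝔰𝔲(2)`: `Σ_μ Re Tr(X·W(x,μ)U(x,μ)^*) = Σ_μ Re Tr(X·U(x−e_μ,μ)^*W(x−e_μ,μ))` (Fermat along `exp(tX)`, as `Prop7OptimalSlice.optimalRepr_site_stationary`, no centre proviso).
[cite: Balaban1985RegularSpaces, (1.38) p.82] -/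
theorem optimalReprAll_site_stationary (U W : GaugeField P j (Matrix.specialUnitaryGroup (Fin 2) ℂ))
    (hopt : ∀ v : GaugeTransf P j (Matrix.specialUnitaryGroup (Fin 2) ℂ),
      ∑ b : PBond P j, ‖pertVar U W b‖ ^ 2 ≤ ∑ b : PBond P j, ‖pertVar U (GaugeField.gaugeAct v W) b‖ ^ 2)
    (x : Site P j) {X : Matrix (Fin 2) (Fin 2) ℂ} (hX : X ∈ skewAdjoint (Matrix (Fin 2) (Fin 2) ℂ)) (htr : X.trace = 0) :
    ∑ μ : Fin P.d, ((X * ((W ⟨x, μ⟩ : Matrix (Fin 2) (Fin 2) ℂ) * star (U ⟨x, μ⟩ : Matrix (Fin 2) (Fin 2) ℂ))).trace).re =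
      ∑ μ : Fin P.d, ((X * (star (U ⟨x.unshift μ, μ⟩ : Matrix (Fin 2) (Fin 2) ℂ) * (W ⟨x.unshift μ, μ⟩ : Matrix (Fin 2) (Fin 2) ℂ))).trace).re := by
  set J₁ : Matrix (Fin 2) (Fin 2) ℂ := ∑ μ : Fin P.d, (W ⟨x, μ⟩ : Matrix (Fin 2) (Fin 2) ℂ) * star (U ⟨x, μ⟩ : Matrix (Fin 2) (Fin 2) ℂ) with hJ₁
  set J₂ : Matrix (Fin 2) (Fin 2) ℂ := ∑ μ : Fin P.d, star (U ⟨x.unshift μ, μ⟩ : Matrix (Fin 2) (Fin 2) ℂ) * (W ⟨x.unshift μ, μ⟩ : Matrix (Fin 2) (Fin 2) ℂ)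
    with hJ₂
  let c : ℝ → Matrix.specialUnitaryGroup (Fin 2) ℂ := fun t => ⟨exp (t • X), Prop8Criticality.exp_smul_mem_su2 hX htr t⟩
  set g : ℝ → ℝ := fun t => (((exp (t • X) - 1) * J₁).trace).re + (((star (exp (t • X)) - 1) * J₂).trace).re with hg
  have hle : ∀ t : ℝ, g t ≤ 0 := fun t => by
    have h1 := optimalReprAll_site_ineq U W hopt x (c t)
    have e : ((c t : Matrix.specialUnitaryGroup (Fin 2) ℂ) : Matrix (Fin 2) (Fin 2) ℂ) = exp (t • X) := rfl
    rw [e] at h1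
    rw [hg]
    simp only [hJ₁, hJ₂, Finset.mul_sum, Matrix.trace_sum, Complex.re_sum]
    exact h1
  have hg0 : g 0 = 0 := by
    rw [hg]
    simp only [zero_smul, exp_zero, star_one, sub_self, zero_mul, Matrix.trace_zero, Complex.zero_re, add_zero]
  have hmax : IsLocalMax g 0 := Filter.Eventually.of_forall fun t => by rw [hg0]; exact hle t
  have hder : HasDerivAt g (((X * J₁).trace).re + ((star X * J₂).trace).re) 0 := by
    rw [hg]; exact hasDerivAt_siteFunctional X J₁ J₂
  have h0 := hmax.hasDerivAt_eq_zero hder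
  have hXs : star X = -X := hX
  rw [hXs, neg_mul, Matrix.trace_neg, Complex.neg_re, ← sub_eq_add_neg, sub_eq_zero] at h0
  simpa only [hJ₁, hJ₂, Finset.mul_sum, Matrix.trace_sum, Complex.re_sum] using h0

end OptAll


/-! ## §3 The point-Landau divergence budgets: `Σ_x‖D^*Y(x)‖²_HS ≤ 2d·s²·Σ_b‖Y_b‖² = 6s²·Σ_b‖Y_b‖²` (+ the centre debit in the pinned case) -/

section Budget

variable {P : Params} {j : ℕ}

/-- Both ends of every bond: `Σ_x (Σ_μ f(x,μ) + Σ_μ f(x−e_μ,μ)) = 2·Σ_b f(b)` (`B10StarCount.sum_pbond` and the translation bijection). [folklore] -/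
theorem sum_incident_eq (f : PBond P j → ℝ) :
    ∑ x : Site P j, (∑ μ : Fin P.d, f ⟨x, μ⟩ + ∑ μ : Fin P.d, f ⟨x.unshift μ, μ⟩) = 2 * ∑ b : PBond P j, f b := by
  rw [Finset.sum_add_distrib, sum_pbond f]
  have h : ∑ x : Site P j, ∑ μ : Fin P.d, f ⟨x.unshift μ, μ⟩ = ∑ x : Site P j, ∑ μ : Fin P.d, f ⟨x, μ⟩ := by
    rw [Finset.sum_comm]
    conv_rhs => rw [Finset.sum_comm]
    refine Finset.sum_congr rfl fun μ _ => ?_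
    rw [← sum_shift μ (fun z => f ⟨z.unshift μ, μ⟩)]
    simp only [Site.unshift_shift]
  rw [h]
  ring

/-- The per-site arithmetic: `D ≤ ½M²`, `0 ≤ M ≤ t` ⟹ `D ≤ ½t·M`. [folklore] -/
theorem le_half_mul_of_le_half_sq {D M t : ℝ} (hD : D ≤ (1 / 2) * M ^ 2) (hM : 0 ≤ M) (hMt : M ≤ t) : D ≤ (1 / 2) * t * M := by
  nlinarith [mul_le_mul_of_nonneg_left hMt hM]

/-- `Σ_μ‖Y(x,μ)‖² + Σ_μ‖Y(x−e_μ,μ)‖² ≤ 2d·s²` when `‖Y_b‖ ≤ s` bondwise. [folklore] -/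
theorem incident_normSq_le (Y : PBond P j → Matrix (Fin 2) (Fin 2) ℂ) {s : ℝ} (hδ : ∀ b : PBond P j, ‖Y b‖ ≤ s) (x : Site P j) :
    ∑ μ : Fin P.d, ‖Y ⟨x, μ⟩‖ ^ 2 + ∑ μ : Fin P.d, ‖Y ⟨x.unshift μ, μ⟩‖ ^ 2 ≤ 2 * P.d * s ^ 2 := by
  have hb : ∀ b : PBond P j, ‖Y b‖ ^ 2 ≤ s ^ 2 := fun b => pow_le_pow_left₀ (norm_nonneg _) (hδ b) 2
  have h1 : ∑ μ : Fin P.d, ‖Y ⟨x, μ⟩‖ ^ 2 ≤ ∑ _μ : Fin P.d, s ^ 2 := Finset.sum_le_sum fun μ _ => hb _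
  have h2 : ∑ μ : Fin P.d, ‖Y ⟨x.unshift μ, μ⟩‖ ^ 2 ≤ ∑ _μ : Fin P.d, s ^ 2 := Finset.sum_le_sum fun μ _ => hb _
  rw [Finset.sum_const, Finset.card_univ, Fintype.card_fin, nsmul_eq_mul] at h1 h2
  linarith

end Budget

section BudgetT3

variable (F : T3Family) {n K : ℕ}

/-- **THE DIVERGENCE BUDGET OF THE UNPINNED `ℓ²`-OPTIMUM** (d = 3 carrier): if `W` is `ℓ²`-optimal over its full gauge orbit relative to `U₀` and `‖W_bU₀(b)^* − 1‖ ≤ s` bondwise, then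
`Σ_xΣ_jk|(D^*_{U₀}Y)(x)_jk|² ≤ 6s²·Σ_b‖Y_b‖²`, `Y = WU₀^* − 1` (per site `≤ ½m_x² ≤ d·s²·m_x`, `Σ_x m_x = 2Σ_b‖Y_b‖²`, `d = 3`).
[cite: Balaban1985RegularSpaces, (1.38) p.82; Balaban1985BackgroundPropagators, (3.8) p.392] -/
theorem sum_hs_divB_le_of_optAll (U₀ W : GaugeField (F.P K) 0 (Matrix.specialUnitaryGroup (Fin 2) ℂ))
    (hopt : ∀ v : GaugeTransf (F.P K) 0 (Matrix.specialUnitaryGroup (Fin 2) ℂ),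
      ∑ b : PBond (F.P K) 0, ‖pertVar U₀ W b‖ ^ 2 ≤ ∑ b : PBond (F.P K) 0, ‖pertVar U₀ (GaugeField.gaugeAct v W) b‖ ^ 2)
    {s : ℝ} (hδ : ∀ b : PBond (F.P K) 0, ‖(W b : Matrix (Fin 2) (Fin 2) ℂ) * star (U₀ b : Matrix (Fin 2) (Fin 2) ℂ) - 1‖ ≤ s) :
    ∑ x : Site (F.P K) 0, ∑ j : Fin 2, ∑ k : Fin 2,
        ‖(divB (torusT (F.P K) 0) (fun κ z => unitsField (toUField U₀) ⟨z, κ⟩)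
          (fun κ z => (W ⟨z, κ⟩ : Matrix (Fin 2) (Fin 2) ℂ) * star (U₀ ⟨z, κ⟩ : Matrix (Fin 2) (Fin 2) ℂ) - 1) x) j k‖ ^ 2
      ≤ 6 * s ^ 2 * ∑ b : PBond (F.P K) 0, ‖(W b : Matrix (Fin 2) (Fin 2) ℂ) * star (U₀ b : Matrix (Fin 2) (Fin 2) ℂ) - 1‖ ^ 2 := by
  have hd : ((F.P K).d : ℝ) = 3 := by norm_num [T3Family.P_d]
  set Y : PBond (F.P K) 0 → Matrix (Fin 2) (Fin 2) ℂ := fun b => (W b : Matrix (Fin 2) (Fin 2) ℂ) * star (U₀ b : Matrix (Fin 2) (Fin 2) ℂ) - 1 with hY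
  have hδ' : ∀ b : PBond (F.P K) 0, ‖Y b‖ ≤ s := fun b => hδ b
  have hper : ∀ x : Site (F.P K) 0, ∑ j : Fin 2, ∑ k : Fin 2,
        ‖(divB (torusT (F.P K) 0) (fun κ z => unitsField (toUField U₀) ⟨z, κ⟩)
          (fun κ z => (W ⟨z, κ⟩ : Matrix (Fin 2) (Fin 2) ℂ) * star (U₀ ⟨z, κ⟩ : Matrix (Fin 2) (Fin 2) ℂ) - 1) x) j k‖ ^ 2
      ≤ (1 / 2) * (2 * (F.P K).d * s ^ 2) * (∑ μ : Fin (F.P K).d, ‖Y ⟨x, μ⟩‖ ^ 2 + ∑ μ : Fin (F.P K).d, ‖Y ⟨x.unshift μ, μ⟩‖ ^ 2) := by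
    intro x
    have h1 := sum_normSq_divB_le_of_siteStationary F U₀ W x (fun X hX htr => optimalReprAll_site_stationary U₀ W hopt x hX htr)
    exact le_half_mul_of_le_half_sq h1 (by positivity) (incident_normSq_le Y hδ' x)
  calc _ ≤ ∑ x : Site (F.P K) 0, (1 / 2) * (2 * (F.P K).d * s ^ 2) * (∑ μ : Fin (F.P K).d, ‖Y ⟨x, μ⟩‖ ^ 2 + ∑ μ : Fin (F.P K).d, ‖Y ⟨x.unshift μ, μ⟩‖ ^ 2) :=
        Finset.sum_le_sum fun x _ => hper x
    _ = (1 / 2) * (2 * (F.P K).d * s ^ 2) * (2 * ∑ b : PBond (F.P K) 0, ‖Y b‖ ^ 2) := by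
        rw [← Finset.mul_sum, sum_incident_eq (fun b => ‖Y b‖ ^ 2)]
    _ = 6 * s ^ 2 * ∑ b : PBond (F.P K) 0, ‖Y b‖ ^ 2 := by rw [hd]; ring

/-- **THE DIVERGENCE BUDGET OF THE PINNED `ℓ²`-OPTIMUM, WITH THE CENTRE DEBIT DISPLAYED** (d = 3 carrier): if `W` is `ℓ²`-optimal over the pinned group (4) relative to `U₀`
(`g↓ = 1`), `‖W_bU₀(b)^* − 1‖ ≤ s`, and `ζ_C ≥ 0` dominates `Σ_jk|(D^*_{U₀}Y)(x)_jk|²` at the `(K−n)`-fold centres, then `Σ_xΣ_jk|(D^*_{U₀}Y)(x)_jk|² ≤ 6s²·Σ_b‖Y_b‖² + Σ_xζ_C(x)`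
(off the centres brick (a) `sum_normSq_divB_optimalRepr_le`; at the centres there is NO condition — the debit is genuine, see the module docstring).
[cite: Balaban1985RegularSpaces, (1.38) p.82; Balaban1985Variational, (4) p.278] -/
theorem sum_hs_divB_le_of_pinnedOpt (h : n ≤ K) (U₀ W : GaugeField (F.P K) 0 (Matrix.specialUnitaryGroup (Fin 2) ℂ))
    (hopt : ∀ v : GaugeTransf (F.P K) 0 (Matrix.specialUnitaryGroup (Fin 2) ℂ), descTransf F n K h v = (fun _ => 1) →
      ∑ b : PBond (F.P K) 0, ‖pertVar U₀ W b‖ ^ 2 ≤ ∑ b : PBond (F.P K) 0, ‖pertVar U₀ (GaugeField.gaugeAct v W) b‖ ^ 2)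
    {s : ℝ} (hδ : ∀ b : PBond (F.P K) 0, ‖(W b : Matrix (Fin 2) (Fin 2) ℂ) * star (U₀ b : Matrix (Fin 2) (Fin 2) ℂ) - 1‖ ≤ s)
    (ζ : Site (F.P K) 0 → ℝ) (hζ0 : ∀ x, 0 ≤ ζ x)
    (hζ : ∀ x : Site (F.P K) 0, (∃ y : Site (F.P K) (K - n), embIter (K - n) y = x) →
      ∑ j : Fin 2, ∑ k : Fin 2, ‖(divB (torusT (F.P K) 0) (fun κ z => unitsField (toUField U₀) ⟨z, κ⟩)
          (fun κ z => (W ⟨z, κ⟩ : Matrix (Fin 2) (Fin 2) ℂ) * star (U₀ ⟨z, κ⟩ : Matrix (Fin 2) (Fin 2) ℂ) - 1) x) j k‖ ^ 2 ≤ ζ x) :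
    ∑ x : Site (F.P K) 0, ∑ j : Fin 2, ∑ k : Fin 2,
        ‖(divB (torusT (F.P K) 0) (fun κ z => unitsField (toUField U₀) ⟨z, κ⟩)
          (fun κ z => (W ⟨z, κ⟩ : Matrix (Fin 2) (Fin 2) ℂ) * star (U₀ ⟨z, κ⟩ : Matrix (Fin 2) (Fin 2) ℂ) - 1) x) j k‖ ^ 2
      ≤ 6 * s ^ 2 * ∑ b : PBond (F.P K) 0, ‖(W b : Matrix (Fin 2) (Fin 2) ℂ) * star (U₀ b : Matrix (Fin 2) (Fin 2) ℂ) - 1‖ ^ 2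
        + ∑ x : Site (F.P K) 0, ζ x := by
  have hd : ((F.P K).d : ℝ) = 3 := by norm_num [T3Family.P_d]
  set Y : PBond (F.P K) 0 → Matrix (Fin 2) (Fin 2) ℂ := fun b => (W b : Matrix (Fin 2) (Fin 2) ℂ) * star (U₀ b : Matrix (Fin 2) (Fin 2) ℂ) - 1 with hY
  have hδ' : ∀ b : PBond (F.P K) 0, ‖Y b‖ ≤ s := fun b => hδ b
  have hm0 : ∀ x : Site (F.P K) 0, 0 ≤ (1 / 2) * (2 * (F.P K).d * s ^ 2) * (∑ μ : Fin (F.P K).d, ‖Y ⟨x, μ⟩‖ ^ 2 + ∑ μ : Fin (F.P K).d, ‖Y ⟨x.unshift μ, μ⟩‖ ^ 2) :=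
    fun x => by positivity
  have hper : ∀ x : Site (F.P K) 0, ∑ j : Fin 2, ∑ k : Fin 2,
        ‖(divB (torusT (F.P K) 0) (fun κ z => unitsField (toUField U₀) ⟨z, κ⟩)
          (fun κ z => (W ⟨z, κ⟩ : Matrix (Fin 2) (Fin 2) ℂ) * star (U₀ ⟨z, κ⟩ : Matrix (Fin 2) (Fin 2) ℂ) - 1) x) j k‖ ^ 2
      ≤ (1 / 2) * (2 * (F.P K).d * s ^ 2) * (∑ μ : Fin (F.P K).d, ‖Y ⟨x, μ⟩‖ ^ 2 + ∑ μ : Fin (F.P K).d, ‖Y ⟨x.unshift μ, μ⟩‖ ^ 2) + ζ x := by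
    intro x
    by_cases hx : ∃ y : Site (F.P K) (K - n), embIter (K - n) y = x
    · exact (hζ x hx).trans (le_add_of_nonneg_left (hm0 x))
    · have hx' : ∀ y : Site (F.P K) (K - n), embIter (K - n) y ≠ x := fun y hy => hx ⟨y, hy⟩
      have h1 := sum_normSq_divB_optimalRepr_le F h U₀ W hopt hx'
      exact (le_half_mul_of_le_half_sq h1 (by positivity) (incident_normSq_le Y hδ' x)).trans (le_add_of_nonneg_right (hζ0 x))
  calc _ ≤ ∑ x : Site (F.P K) 0, ((1 / 2) * (2 * (F.P K).d * s ^ 2) * (∑ μ : Fin (F.P K).d, ‖Y ⟨x, μ⟩‖ ^ 2 + ∑ μ : Fin (F.P K).d, ‖Y ⟨x.unshift μ, μ⟩‖ ^ 2) + ζ x) :=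
        Finset.sum_le_sum fun x _ => hper x
    _ = (1 / 2) * (2 * (F.P K).d * s ^ 2) * (2 * ∑ b : PBond (F.P K) 0, ‖Y b‖ ^ 2) + ∑ x : Site (F.P K) 0, ζ x := by
        rw [Finset.sum_add_distrib, ← Finset.mul_sum, sum_incident_eq (fun b => ‖Y b‖ ^ 2)]
    _ = 6 * s ^ 2 * ∑ b : PBond (F.P K) 0, ‖Y b‖ ^ 2 + ∑ x : Site (F.P K) 0, ζ x := by rw [hd]; ring

end BudgetT3

end Summit.QuantumFields.YangMills.Theorems.Prop7PointLandauBudget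

end
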